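import Literature.Computability.Cryptography.LWEBinaryHybrids
import HarnessLib

/-!
# BLPRS 2013, Lemma 4.9: the first hybrid step `H₀ ≈ H₁` reduced to one-dimensional noise closeness, and the full chain

Topic `Computability/Cryptography` (LWE), grouping namespace `LWE`; sequel of `LWEBinaryHybrids.lean` (the
hybrid chain `H₁ → H₅`, `advantage_hybridH₁_le`). Proved glue (no named fact) towards pqc.S21: the printed
first step

> *"Using `‖z‖ ≤ √n` and that `β ≥ √2 η_ε(ℤⁿ)/q`, it follows by Lemma 2.9 that the statistical distance
> between `-Nᵀz + h` and `D^m_{α'}` is at most `4mε`. It thus follows that `|Pr[𝒜(H₀)] - Pr[𝒜(H₁)]| ≤ 4mε`."*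
> (arXiv:1306.0281, proof of Lemma 4.9)

is, in the discrete model, the statement that for every secret `z` the one-coordinate noise laws
`χ₀(z̄)` (the real noise of `binLWE_{n,m,q,≤α}` for that secret) and `noiseH₁ χ_N χ_h z̄` (the law of
`h - ⟨ē, z̄⟩`) are `η`-close; the `m` independent samples then differ by at most `m η` (the tree's iid
hybrid bound and kernel contraction), uniformly over the secret law. Adding this to the chain gives
Lemma 4.9 in full, with the analytic input isolated as the hypothesis `hη` (Lemma 2.9, measure level).

## Results

* `hybridH₀ χ₀ m ζ` — `H₀`: `LWE` samples with secret law `ζ̄` and secret-dependent noise `χ₀`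
  (`= lweSamplesSecretNoiseLaw χ₀ (ζ.map intCastVec) m`);
* `tvDist_hybridH₀_hybridH₁_le` — `Δ(H₀, H₁) ≤ m η` if `Δ(χ₀(z̄), noiseH₁ χ_N χ_h z̄) ≤ η` for all `z`;
* **`advantage_hybridH₀_le`** — Lemma 4.9 in full:
  `|Pr[𝒜(H₀)] - Pr[𝒜(U)]| ≤ m η + Adv^{extLWE^m,ζ}[ℬ₁] + Δ((C, Cz̄); U) + Adv^{LWE_k}[ℬ₂] + Adv^{extLWE^m,0}[ℬ₃]`
  (printed: `4mε + Adv[ℬ₁] + δ + Adv[ℬ₂] + Adv[ℬ₃]`).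

## References

* Z. Brakerski, A. Langlois, C. Peikert, O. Regev, D. Stehlé, *Classical hardness of learning with errors*,
  STOC 2013; arXiv:1306.0281, Lemma 4.9 and its proof (first hybrid), Lemma 2.9.
-/

noncomputable section

open scoped ENNReal
open Matrix Literature.Probability.Distributions

namespace Literature.Computability.Cryptography

namespace LWE

variable {R : Type} [CommRing R] [Fintype R] {k n : ℕ}

/-- **`H₀ = (A, Aᵀz + e)`**: `LWE` samples for the secret law `ζ̄` with a secret-dependent noise law `χ₀`
(for `binLWE_{n,m,q,≤α}`: `χ₀(z̄) = D_{α'}`, `α' = √(β²‖z‖² + γ²) ≤ α`). [cite: BrakerskiEtAl2013, Lemma 4.9 (proof, hybrid H₀)] -/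
def hybridH₀ (χ₀ : (Fin n → R) → PMF R) (m : ℕ) (ζ : PMF (Fin n → ℤ)) : PMF (Fin m → (Fin n → R) × R) :=
  ζ.bind fun z => lweSamples (χ₀ (intCastVec z)) (intCastVec z : Fin n → R) m

/-- `H₀` is the tree's `lweSamplesSecretNoiseLaw` for the secret law `ζ̄`. [cite: BrakerskiEtAl2013, Lemma 4.9 (proof) with Def. 2.14] -/
theorem hybridH₀_eq (χ₀ : (Fin n → R) → PMF R) (m : ℕ) (ζ : PMF (Fin n → ℤ)) :
    hybridH₀ χ₀ m ζ = lweSamplesSecretNoiseLaw χ₀ (ζ.map intCastVec) m := by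
  rw [lweSamplesSecretNoiseLaw, PMF.bind_map]
  rfl

/-- **`Δ(H₀, H₁) ≤ m η`** whenever the one-coordinate noise laws are `η`-close for every secret: the `m`
samples are independent given `z` (`tvDist_iidPMF_le` through `lweSample`, then the mixture over `z`).
[cite: BrakerskiEtAl2013, Lemma 4.9 (proof: "statistical distance … at most 4mε")] -/
theorem tvDist_hybridH₀_hybridH₁_le (χ₀ : (Fin n → R) → PMF R) (χN : PMF (Fin n → ℤ)) (χh : PMF R) (m : ℕ)
    (ζ : PMF (Fin n → ℤ)) {η : ℝ} (hη : ∀ z : Fin n → ℤ, (χ₀ (intCastVec z)).tvDist (noiseH₁ χN χh (intCastVec z)) ≤ η) :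
    (hybridH₀ χ₀ m ζ).tvDist (hybridH₁ χN χh m ζ) ≤ m * η := by
  unfold hybridH₀ hybridH₁
  refine PMF.tvDist_bind_le_of_forall_le ζ _ _ fun z => ?_
  have hiid := tvDist_iidPMF_le (lweSample (χ₀ (intCastVec z)) (intCastVec z : Fin n → R))
    (lweSample (noiseH₁ χN χh (intCastVec z)) (intCastVec z : Fin n → R)) m
  refine hiid.trans (mul_le_mul_of_nonneg_left ?_ (Nat.cast_nonneg m))
  unfold lweSample
  exact (PMF.tvDist_bind_le_of_forall_le _ _ _ fun a => PMF.tvDist_map_le_holds _ _ _).trans (hη z)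

variable (k) in
/-- **BLPRS Lemma 4.9 in full (discrete model, analytic input as a hypothesis).** If for every secret `z`
the real noise `χ₀(z̄)` is `η`-close to `noiseH₁ χ_N χ_h z̄` (Lemma 2.9: `η = 4ε`), then for every test `𝒜`,
`|Pr[𝒜(H₀)] - Pr[𝒜(U)]| ≤ m η + Adv^{extLWE^m, z←ζ}[ℬ₁] + Δ((C, Cz̄); U) + Adv^{LWE_{k,m,χ_h}}[ℬ₂] + Adv^{extLWE^m, z=0}[ℬ₃]`.
[cite: BrakerskiEtAl2013, Lemma 4.9] -/
theorem advantage_hybridH₀_le (χ₀ : (Fin n → R) → PMF R) (χN : PMF (Fin n → ℤ)) (χh : PMF R) (m : ℕ)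
    (ζ : PMF (Fin n → ℤ)) {η : ℝ}
    (hη : ∀ z : Fin n → ℤ, (χ₀ (intCastVec z)).tvDist (noiseH₁ χN χh (intCastVec z)) ≤ η)
    (A : Distinguisher (Fin n) R m) :
    |(acceptProb A (hybridH₀ χ₀ m ζ)).toReal - (acceptProb A (uniformSamples (Fin n) R m)).toReal| ≤
      m * η + (extLWEAdvantageZ ζ χN m (hybridB₁ (k := k) χh m A) +
        (lawCz k ζ).tvDist (PMF.uniformOfFintype (Matrix (Fin k) (Fin n) R × (Fin k → R))) +
        distinguishingAdvantage χh m (hybridB₂ (k := k) χN m A) +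
        extLWEAdvantage χN m 0 (hybridB₃ (k := k) m A)) := by
  have h01 : |(acceptProb A (hybridH₀ χ₀ m ζ)).toReal - (acceptProb A (hybridH₁ χN χh m ζ)).toReal| ≤ m * η :=
    (abs_toReal_acceptProb_sub_le_tvDist A _ _).trans (tvDist_hybridH₀_hybridH₁_le χ₀ χN χh m ζ hη)
  have h15 := advantage_hybridH₁_le (k := k) χN χh m ζ A
  have t := abs_sub_le (acceptProb A (hybridH₀ χ₀ m ζ)).toReal (acceptProb A (hybridH₁ χN χh m ζ)).toReal
    (acceptProb A (uniformSamples (Fin n) R m)).toReal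
  linarith

end LWE

end Literature.Computability.Cryptography

end
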